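import Summits.QuantumFields.YangMills.Theorems.UniversalDetectorBlindSliceIdentity
import Summits.QuantumFields.YangMills.Theorems.UniversalDetectorBlindMirrorCauchySchwarz
import Summits.QuantumFields.YangMills.Theorems.UniversalDetectorBlindGaussDeconv
import Summits.QuantumFields.YangMills.Theorems.UniversalDetectorExpConvexNull
import Literature.Analysis.FunctionSpaces.GaussianSchwartz
import Literature.MathematicalPhysics.QuantumLattice.EuclideanAction

/-!
# LINES g11-1 «blind detector» / g11-2 «engine tori» (planner ym-idea-8 g11): the shared analysis stub
`BlindDetectorRigidity` — OS/Laplace rigidity of the universal detector, BLIND to the coordinate hyperplanes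

Shared analysis stub of the supports `UniversalDetector.BlindDetector` (stmt-QuantumFields-24148) and
`FixedTorusFirst.SomeTorusDetector` (stmt-QuantumFields-24177); the statement of `blindDetectorRigidity` below is the text of
`BlindDetectorRigidity` in the NT-side skeleton `Cruxes/NT/Lines/blind_detector.lean` VERBATIM (that module is not importable):
the landed crux `UniversalDetector.DetectorRigidity` (`Cruxes.DetectorRigidity.detectorRigidity`) with `Measurable K ∧
ContinuousOn K Ω`, `Ω = {z : z_i ≠ 0 ∀ i}`, in place of `ContinuousOn K {z ≠ 0}`, WITHOUT the coordinate-permutation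
hypothesis, and with the conclusion `K = 0` on `Ω`.

Proof = the landed chain re-threaded: `blindSemigroupKill` is `semigroupKill_of_slice_of_cs` fed with the blind slice
identity (`blindSliceIdentity`) and the measurable mirror Cauchy–Schwarz (`blindMirrorCauchySchwarz`) — reflection positivity
makes the Hankel form of the slice profile `Φ` positive semi-definite, the null detector `v₀` makes `h e^{-s²}` a null
vector, `expConvexKernel_eq_zero_of_null` kills `Φ` on `(0,∞)`, so every Gaussian-profile vector is null, and Cauchy–Schwarz
kills every (Gaussian-profile, positive-slab) pairing; `blindGaussDeconv` then gives `K = 0` on `Ω ∩ {z₀ > 0}`, and the time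
reflection `ϑ` alone (no permutations: `Ω` is `ϑ`-stable and misses `{z₀ = 0}`) gives `Ω ∩ {z₀ < 0}`.

HONEST LABEL: one shared analysis stub of two NT-side skeletons; the items 24148 / 24177 still need the sequential blind
extraction `BlindSeqExtraction` (XL); no crux, rung or summit is proved; `BalabanLadder.NT` and the Yang–Mills mass gap are
NOT proved.  Refs: Glimm–Jaffe (1987) §6.1; Osterwalder–Schrader (1973/75) [folklore re-threading of landed proofs].
-/

set_option autoImplicit false

noncomputable section

open MeasureTheory Filter Set
open scoped ContDiff Topology
open Literature.MathematicalPhysics.QuantumLattice Literature.Analysis.FunctionSpaces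

namespace Summit.QuantumFields.YangMills.Cruxes.BlindDetectorRigidity

open Summit.QuantumFields.YangMills.Cruxes.DetectorRigidity (expConvexKernel_eq_zero_of_null)


/-- The time coordinate is continuous on `ℝ⁴`. -/
private theorem continuous_coord' : Continuous fun y : EuclideanSpace ℝ (Fin 4) => y 0 :=
  (EuclideanSpace.proj (0 : Fin 4) : EuclideanSpace ℝ (Fin 4) →L[ℝ] ℝ).continuous

/-- The positive time slab `{t ≤ y₀ ≤ T}` is closed. -/
private theorem isClosed_slab (t T : ℝ) : IsClosed {y : EuclideanSpace ℝ (Fin 4) | t ≤ y 0 ∧ y 0 ≤ T} :=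
  (isClosed_le continuous_const continuous_coord').inter (isClosed_le continuous_coord' continuous_const)

/-- The support of a sum sits inside the union of the supports. -/
private theorem tsupport_add_subset' {F G : ℝ → ℝ} :
    tsupport (fun x => F x + G x) ⊆ tsupport F ∪ tsupport G := by
  simpa only [tsupport, closure_union] using closure_mono (Function.support_add F G)

/-- A Gaussian-profile vector `w(y) = a(y₀) e^{-‖y‖²}` whose profile is supported in `[t, T]` is supported in the slab
`{t ≤ y₀ ≤ T}`. -/
private theorem tsupport_subset_slab {w : SchwartzMap (EuclideanSpace ℝ (Fin 4)) ℝ} {a : ℝ → ℝ} {t T : ℝ}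
    (hw : ∀ y, w y = a (y 0) * Real.exp (-‖y‖ ^ 2)) (ha : tsupport a ⊆ Icc t T) :
    tsupport (w : EuclideanSpace ℝ (Fin 4) → ℝ) ⊆ {y | t ≤ y 0 ∧ y 0 ≤ T} := by
  refine closure_minimal (fun y hy => ?_) (isClosed_slab t T)
  have hy' : a (y 0) ≠ 0 := by
    intro h0
    exact hy (by rw [hw, h0, zero_mul])
  exact ha (subset_tsupport _ (Function.mem_support.mpr hy'))

/-- **Blind semigroup kill.**  For `K` measurable, continuous on `Ω`, bounded away from the origin, even, `ϑ`-invariant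
and reflection positive on positive slabs: if the mirror pairing of ONE non-negative Gaussian-profile detector `v₀` vanishes,
then the mirror pairing of every (Gaussian-profile, positive-slab) pair vanishes.  (The landed `semigroupKill_of_slice_of_cs`
with the blind slice identity and the measurable mirror Cauchy–Schwarz as inputs; its permutation hypothesis was unused.)
[folklore] -/
theorem blindSemigroupKill :
    ∀ (K : EuclideanSpace ℝ (Fin 4) → ℝ) (h : ℝ → ℝ) (ta tb : ℝ)
      (v₀ : SchwartzMap (EuclideanSpace ℝ (Fin 4)) ℝ),
    Measurable K → ContinuousOn K {z | ∀ i : Fin 4, z i ≠ 0} →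
    (∀ η : ℝ, 0 < η → ∃ C : ℝ, ∀ z : EuclideanSpace ℝ (Fin 4), η ≤ ‖z‖ → |K z| ≤ C) →
    (∀ z : EuclideanSpace ℝ (Fin 4), K (-z) = K z) →
    (∀ z : EuclideanSpace ℝ (Fin 4), K (timeReflection 4 z) = K z) →
    (∀ (w : SchwartzMap (EuclideanSpace ℝ (Fin 4)) ℝ) (t₀ T : ℝ), 0 < t₀ →
      tsupport (w : EuclideanSpace ℝ (Fin 4) → ℝ) ⊆ {y | t₀ ≤ y 0 ∧ y 0 ≤ T} →
      0 ≤ ∫ x, ∫ y, (thetaTest 4 w) x * w y * K (y - x)) →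
    0 < ta → Continuous h → (∀ t, 0 ≤ h t) → tsupport h ⊆ Set.Icc ta tb → (∃ t, h t ≠ 0) →
    (∀ y, v₀ y = h (y 0) * Real.exp (-‖y‖ ^ 2)) →
    (∫ x, ∫ y, (thetaTest 4 v₀) x * v₀ y * K (y - x)) = 0 →
    ∀ (w₁ w₂ : SchwartzMap (EuclideanSpace ℝ (Fin 4)) ℝ) (h₁ : ℝ → ℝ) (t₁ T₁ t₂ T₂ : ℝ),
      0 < t₁ → Continuous h₁ → tsupport h₁ ⊆ Set.Icc t₁ T₁ →
      (∀ y, w₁ y = h₁ (y 0) * Real.exp (-‖y‖ ^ 2)) → 0 < t₂ →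
      tsupport (w₂ : EuclideanSpace ℝ (Fin 4) → ℝ) ⊆ {y | t₂ ≤ y 0 ∧ y 0 ≤ T₂} →
      (∫ x, ∫ y, (thetaTest 4 w₁) x * w₂ y * K (y - x)) = 0 := by
  intro K h ta tb v₀ hKm hcΩ hb he hθ hrp hta hh h0 hsupp hne hv hpair w₁ w₂ h₁ t₁ T₁ t₂ T₂ ht₁ hh₁
    hsupp₁ hw₁ ht₂ hsupp₂
  obtain ⟨Φ, κ, hκ, hΦ, hid⟩ := blindSliceIdentity K hKm hcΩ hb
  -- compactly supported profiles
  have hhc : HasCompactSupport h := isCompact_Icc.of_isClosed_subset (isClosed_tsupport _) hsupp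
  have hh0' : tsupport h ⊆ Ioi 0 := fun x hx => lt_of_lt_of_le hta (hsupp hx).1
  have hh₁c : HasCompactSupport h₁ := isCompact_Icc.of_isClosed_subset (isClosed_tsupport _) hsupp₁
  have hh₁0 : tsupport h₁ ⊆ Ioi 0 := fun x hx => lt_of_lt_of_le ht₁ (hsupp₁ hx).1
  -- the null profile `h̃ = h e^{-s²}`
  set hn : ℝ → ℝ := fun s => h s * Real.exp (-s ^ 2) with hn_def
  have hn_cont : Continuous hn := hh.mul (Real.continuous_exp.comp (continuous_id.pow 2).neg)
  have hn_cs : HasCompactSupport hn := hhc.mul_right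
  have hn_0 : tsupport hn ⊆ Ioi 0 := tsupport_mul_subset_left.trans hh0'
  have hn_nn : ∀ x, 0 ≤ hn x := fun x => mul_nonneg (h0 x) (Real.exp_pos _).le
  have hn_ne : ∃ x, hn x ≠ 0 := by
    obtain ⟨x, hx⟩ := hne
    exact ⟨x, mul_ne_zero hx (Real.exp_pos _).ne'⟩
  -- `Φ ≡ 0` on `(0,∞)` by the rigidity theorem
  have hΦ0 : ∀ u, 0 < u → Φ u = 0 := by
    refine expConvexKernel_eq_zero_of_null Φ hΦ hn hn_cont hn_cs hn_0 hn_nn hn_ne ?_ ?_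
    · -- positive semi-definiteness from reflection positivity
      intro c g hgd hgc hg0
      -- the profile `a = c h + g e^{s²}` and its Schwartz vector `W = c v₀ + w_g`
      set G : ℝ → ℝ := fun s => g s * Real.exp (s ^ 2) with hG_def
      have hG_smooth : ContDiff ℝ ∞ G := hgd.mul (Real.contDiff_exp.comp (contDiff_id.pow 2))
      have hG_cs : HasCompactSupport G := hgc.mul_right
      have htg : (fun y : EuclideanSpace ℝ (Fin 4) => G (y 0)).HasTemperateGrowth :=
        (hG_cs.hasTemperateGrowth hG_smooth).comp
          (EuclideanSpace.proj (0 : Fin 4) : EuclideanSpace ℝ (Fin 4) →L[ℝ] ℝ).hasTemperateGrowth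
      set wg : SchwartzMap (EuclideanSpace ℝ (Fin 4)) ℝ :=
        SchwartzMap.smulLeftCLM ℝ (fun y : EuclideanSpace ℝ (Fin 4) => G (y 0))
          (realGaussianSchwartz (EuclideanSpace ℝ (Fin 4)) 1) with hwg_def
      have hwg : ∀ y, wg y = G (y 0) * Real.exp (-‖y‖ ^ 2) := by
        intro y
        rw [hwg_def, SchwartzMap.smulLeftCLM_apply_apply htg, realGaussianSchwartz_apply one_pos,
          smul_eq_mul, neg_mul, one_mul]
      set a : ℝ → ℝ := fun s => c * h s + G s with ha_def
      have ha_cont : Continuous a := (continuous_const.mul hh).add hG_smooth.continuous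
      have ha_cs : HasCompactSupport a := (hhc.mul_left).add hG_cs
      have ha_0 : tsupport a ⊆ Ioi 0 :=
        tsupport_add_subset'.trans (union_subset (tsupport_mul_subset_right.trans hh0')
          ((tsupport_mul_subset_left (f := g)).trans hg0))
      set W : SchwartzMap (EuclideanSpace ℝ (Fin 4)) ℝ := c • v₀ + wg with hW_def
      have hW : ∀ y, W y = a (y 0) * Real.exp (-‖y‖ ^ 2) := by
        intro y
        rw [hW_def, add_apply, smul_apply, hv, hwg, ha_def, smul_eq_mul]
        ring
      -- slab support of `W`
      set S : Set ℝ := tsupport h ∪ tsupport g with hS_def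
      have hS : IsCompact S := hhc.union hgc
      have hSne : S.Nonempty := by
        obtain ⟨x, hx⟩ := hne
        exact ⟨x, Or.inl (subset_tsupport _ (Function.mem_support.mpr hx))⟩
      have hS0 : S ⊆ Ioi 0 := union_subset hh0' hg0
      have ht₀ : 0 < sInf S := hS0 (hS.sInf_mem hSne)
      have haS : tsupport a ⊆ Icc (sInf S) (sSup S) := by
        have h1 : tsupport a ⊆ S :=
          tsupport_add_subset'.trans (union_subset_union tsupport_mul_subset_right
            (tsupport_mul_subset_left (f := g)))
        intro x hx
        exact ⟨csInf_le hS.bddBelow (h1 hx), le_csSup hS.bddAbove (h1 hx)⟩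
      have hWsupp := tsupport_subset_slab hW haS
      have hRP := hrp W (sInf S) (sSup S) ht₀ hWsupp
      rw [hid a a W W ha_cont ha_cont ha_cs ha_cs ha_0 ha_0 hW hW] at hRP
      have hQ : 0 ≤ ∫ p : ℝ × ℝ, (a p.1 * Real.exp (-p.1 ^ 2)) * (a p.2 * Real.exp (-p.2 ^ 2)) * Φ (p.1 + p.2) :=
        (mul_nonneg_iff_of_pos_left hκ).mp hRP
      have ha' : ∀ s, a s * Real.exp (-s ^ 2) = c * hn s + g s := by
        intro s
        simp only [ha_def, hn_def, hG_def]
        rw [add_mul, mul_assoc (g s), ← Real.exp_add, add_neg_cancel, Real.exp_zero, mul_one, mul_assoc]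
      simpa only [ha'] using hQ
    · -- the null vector
      have h1 := hid h h v₀ v₀ hh hh hhc hhc hh0' hh0' hv hv
      rw [hpair] at h1
      have h2 : ∫ p : ℝ × ℝ, (h p.1 * Real.exp (-p.1 ^ 2)) * (h p.2 * Real.exp (-p.2 ^ 2)) * Φ (p.1 + p.2) = 0 := by
        rcases mul_eq_zero.mp h1.symm with h3 | h3
        · exact absurd h3 hκ.ne'
        · exact h3
      simpa only [hn_def] using h2
  -- every Gaussian-profile vector is null
  have hB11 : (∫ x, ∫ y, (thetaTest 4 w₁) x * w₁ y * K (y - x)) = 0 := by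
    rw [hid h₁ h₁ w₁ w₁ hh₁ hh₁ hh₁c hh₁c hh₁0 hh₁0 hw₁ hw₁]
    have : (fun p : ℝ × ℝ => (h₁ p.1 * Real.exp (-p.1 ^ 2)) * (h₁ p.2 * Real.exp (-p.2 ^ 2)) * Φ (p.1 + p.2)) =
        fun _ => 0 := by
      funext p
      by_cases h1 : h₁ p.1 = 0
      · simp [h1]
      by_cases h2 : h₁ p.2 = 0
      · simp [h2]
      have h1' : 0 < p.1 := hh₁0 (subset_tsupport _ (Function.mem_support.mpr h1))
      have h2' : 0 < p.2 := hh₁0 (subset_tsupport _ (Function.mem_support.mpr h2))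
      simp [hΦ0 _ (add_pos h1' h2')]
    rw [this, integral_const, smul_zero, mul_zero]
  -- Cauchy–Schwarz
  exact blindMirrorCauchySchwarz K hKm hb he hθ hrp w₁ w₂ t₁ T₁ t₂ T₂ ht₁ (tsupport_subset_slab hw₁ hsupp₁) ht₂ hsupp₂ hB11


/-- **`BlindDetectorRigidity`** (the shared analysis stub of `UniversalDetector.BlindDetector`, stmt-QuantumFields-24148, and
`FixedTorusFirst.SomeTorusDetector`, stmt-QuantumFields-24177; statement = `Cruxes/NT/Lines/blind_detector.lean`'s
`BlindDetectorRigidity` verbatim): a measurable kernel, continuous on `Ω = {all coordinates ≠ 0}`, bounded away from the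
origin, even, `ϑ`-invariant and reflection positive on positive slabs, whose mirror pairing annihilates one non-negative
Gaussian-profile detector, vanishes on `Ω`.  Blind semigroup kill + blind Gaussian deconvolution on `Ω ∩ {z₀ > 0}`, then `ϑ`.
No crux, rung or summit is proved. [folklore] -/
theorem blindDetectorRigidity :
    ∀ (K : EuclideanSpace ℝ (Fin 4) → ℝ) (h : ℝ → ℝ) (ta tb : ℝ) (v₀ : SchwartzMap (EuclideanSpace ℝ (Fin 4)) ℝ),
      Measurable K → ContinuousOn K {z | ∀ i : Fin 4, z i ≠ 0} →
      (∀ η : ℝ, 0 < η → ∃ C : ℝ, ∀ z : EuclideanSpace ℝ (Fin 4), η ≤ ‖z‖ → |K z| ≤ C) →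
      (∀ z : EuclideanSpace ℝ (Fin 4), K (-z) = K z) →
      (∀ z : EuclideanSpace ℝ (Fin 4), K (timeReflection 4 z) = K z) →
      (∀ (w : SchwartzMap (EuclideanSpace ℝ (Fin 4)) ℝ) (t₀ T : ℝ), 0 < t₀ →
        tsupport (w : EuclideanSpace ℝ (Fin 4) → ℝ) ⊆ {y | t₀ ≤ y 0 ∧ y 0 ≤ T} →
        0 ≤ ∫ x, ∫ y, (thetaTest 4 w) x * w y * K (y - x)) →
      0 < ta → Continuous h → (∀ t, 0 ≤ h t) → tsupport h ⊆ Set.Icc ta tb → (∃ t, h t ≠ 0) →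
      (∀ y, v₀ y = h (y 0) * Real.exp (-‖y‖ ^ 2)) →
      (∫ x, ∫ y, (thetaTest 4 v₀) x * v₀ y * K (y - x)) = 0 →
      ∀ z : EuclideanSpace ℝ (Fin 4), (∀ i : Fin 4, z i ≠ 0) → K z = 0 := by
  intro K h ta tb v₀ hKm hcΩ hb he hθ hrp hta hh h0 hsupp hne hv hpair z hzΩ
  have hkill := blindSemigroupKill K h ta tb v₀ hKm hcΩ hb he hθ hrp hta hh h0 hsupp hne hv hpair
  have hpos : ∀ z : EuclideanSpace ℝ (Fin 4), (∀ i : Fin 4, z i ≠ 0) → 0 < z 0 → K z = 0 :=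
    blindGaussDeconv K hKm hcΩ hb hkill
  rcases lt_or_gt_of_ne (hzΩ 0) with hneg | hpos'
  · -- negative time: reflect (`Ω` is `ϑ`-stable)
    rw [← hθ z]
    refine hpos _ (fun i => ?_) ?_
    · rw [timeReflection_apply]
      split_ifs with hi
      · subst hi; exact neg_ne_zero.mpr (hzΩ 0)
      · exact hzΩ i
    · rw [timeReflection_apply, if_pos rfl]
      linarith
  · exact hpos z hzΩ hpos'

end Summit.QuantumFields.YangMills.Cruxes.BlindDetectorRigidity

end
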